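import Literature.Barriers.SmoothPoincare4.WeaklyReducibleGenusThreeStandardOfLoopSurgery
import Literature.Topology.FourManifolds.ReducibleTrisectionNotSimplyConnected
import HarnessLib

/-!
# Aranda–Zupan's genus-three fact: the `π₁`-shadow of the non-separating case DISCHARGED

Barrier catalogue `Literature/Barriers/SmoothPoincare4/` (D-0021), companion of
`WeaklyReducibleGenusThreeStandard(Proofs|OfLoopSurgery).lean` and
`LowGenusTrisectionsStandardOfClassification.lean` (the named fact
`az2025_weaklyReducible_genusThree_homotopySphere_gk`: a smooth homotopy 4-sphere with a weakly
reducible genus-three Gay–Kirby trisection is `S⁴`; Aranda–Zupan, arXiv:2503.04607, Thm. 1.3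
restricted to homotopy spheres).  **Everything here is proved; no definition, no named fact.**

The assemblies of the companions take the `π₁`-SHADOW of the non-separating reducible case —
*a GK-trisected closed 4-manifold with a non-separating reducing curve is not simply connected*
(Aranda–Zupan §2 p. 6: such a trisection splits off the genus-one trisection of `S¹ × S³`) — as
an inline hypothesis `hπ` / `hπ₀`, in the binder shape of
`Trisection.not_simplyConnectedSpace_of_reducing_nonseparating_of_fact` minus its fact argument.
That shadow is now a THEOREM of the tree,
`Literature.Topology.FourManifolds.Trisection.not_simplyConnectedSpace_of_reducing_nonseparating`
(`ReducibleTrisectionNotSimplyConnected.lean`: circle-valued collapse maps of the three two-sided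
compressing discs, a dual loop of winding number one, van Kampen over the trisection), with FEWER
hypotheses (no orientation, compactness, connectedness or essentiality of the curve is needed).
This file feeds it in, removing the hypothesis from every assembly:

* `nonempty_diffeomorph_sphere_of_isReducible_genusThree_of_sep` — **the REDUCIBLE branch for
  homotopy 4-spheres, GIVEN only the separating splitting fact
  `Trisection.isConnectedSum_of_reducing_separating` and the genus-`≤ 2` fact
  `mz_genus_le_two_homotopySphere_gk`**: on a simply connected `X` every reducing curve
  separates (the theorem), and the separating case is
  `nonempty_diffeomorph_sphere_of_reducing_separating_genusThree_of_fact` (Aranda–Zupan §6 p. 20,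
  first paragraph; Kosinski VI.2.1 and `S⁴ # S⁴ ≅ S⁴`, both discharged in the tree);
* `az2025_weaklyReducible_genusThree_homotopySphere_gk_of_msz_of_sep_of_irreducible` — **where
  the fact stands**: at universe `u` it follows from `msz_homotopySphere_gk.{u}`
  (Meier–Schirmer–Zupan, homotopy-sphere form), the separating splitting fact at `u`, and
  Aranda–Zupan's IRREDUCIBLE CORE `hirr` (inline; the diagrammatic heart of the paper, Prop. 3.9,
  §4, §5, NOT vendored — D-0026);
* `az2025_weaklyReducible_genusThree_homotopySphere_gk_of_msz_zero_of_sep_zero_of_irreducible_zero`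
  and `…_of_classification_of_sep_zero_of_irreducible_zero` — `Type 0` data suffice: the fact at
  EVERY universe from `msz_homotopySphere_gk.{0}` (or the classification
  `msz_trisection_classification_gk` at any universe), the separating splitting fact at `0` and
  the core for `X : Type`;
* `az2025_weaklyReducible_genusThree_homotopySphere_gk_of_classification_of_sep_of_loopSurgery_of_fiveChainSurgery'`
  and `…_of_msz_zero_of_sep_of_loopSurgery_of_fiveChainSurgery'` — the printed ENDGAME forms of
  `WeaklyReducibleGenusThreeStandardOfLoopSurgery.lean` without `hπ₀`: the fact at every universe
  from the classification (any universe) or `msz_homotopySphere_gk.{0}`, the separating splitting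
  fact at `0`, the loop-surgery fact `msz_loopSurgery_homotopySphere_gk` and the FIVE-CHAIN
  SURGERY STEP `h5` (Aranda–Zupan Thm. 1.3 first part + Lemma 5.4 + Prop. 5.5, inline).

After this file the named inputs of the fact are exactly: `msz_trisection_classification_gk`
(or its corollary `msz_homotopySphere_gk`), `Trisection.isConnectedSum_of_reducing_separating`,
`msz_loopSurgery_homotopySphere_gk` — three existing named facts of the tree — and the five-chain
surgery step, the part of Aranda–Zupan's paper that is specific to it.

## References

* R. Aranda, A. Zupan, *Manifolds with weakly reducible genus-three trisections are standard*,
  arXiv:2503.04607 (2025), Thm. 1.3 (p. 2), §2 (p. 6), Lemma 5.4, Prop. 5.5 (pp. 19–20),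
  §6 (pp. 20–24). [ArandaZupan2025]
* J. Meier, T. Schirmer, A. Zupan, *Classification of trisections and the Generalized Property R
  Conjecture*, Proc. AMS 144 (2016) 4983–4997, Thm. 1.2. [MeierSchirmerZupan2016]
* J. Meier, A. Zupan, *Genus-two trisections are standard*, Geom. Topol. 21 (2017), Thm. 1.2.
  [MeierZupan2017]
* A. Hatcher, *Algebraic Topology*, CUP (2002), Prop. 1.26 (van Kampen). [HatcherAT2002]
-/

noncomputable section

open scoped Manifold ContDiff Topology
open Set ContinuousMap

namespace Literature.Barriers.SmoothPoincare4

universe u v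

open Literature.Topology.FourManifolds Literature.Topology.FourManifolds.Trisection

/-! ### The shadow in the binder shape of the assemblies -/

/-- **The `π₁`-shadow of the non-separating reducible case, in the binder shape used by the
assemblies of the companions** (orientation, genus, essentiality of the curve, compactness and
connectedness are accepted and ignored): a GK-trisected smooth 4-manifold with a non-separating
curve on the central surface bounding a compressing disc in each of the three handlebodies of the
spine is not simply connected — the tree's theorem
`Trisection.not_simplyConnectedSpace_of_reducing_nonseparating`.
[cite: ArandaZupan2025, §2 (p. 6)] [cite: HatcherAT2002, Prop. 1.26] -/
theorem not_simplyConnectedSpace_of_reducing_nonseparating_binderShape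
    (X : Type u) [TopologicalSpace X] [T2Space X] [SecondCountableTopology X]
    [ChartedSpace (EuclideanSpace ℝ (Fin 4)) X] [IsManifold (𝓡 4) ∞ X] [CompactSpace X]
    [ConnectedSpace X] (_o : SmoothOrientation (𝓡 4) X) (g : ℕ) (k : Fin 3 → ℕ)
    (S : Fin 3 → Set X) (δ : Set X) (hT : IsGKTrisection X g k S) (hc : IsCurve S δ)
    (_hess : ¬ ∃ e : Metric.closedBall (0 : EuclideanSpace ℝ (Fin 2)) 1 → X,
      Manifold.IsSmoothEmbedding (𝓡∂ 2) (𝓡 4) ∞ e ∧ range e ⊆ centralSurfaceSet S ∧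
        e '' (𝓡∂ 2).boundary (Metric.closedBall (0 : EuclideanSpace ℝ (Fin 2)) 1) = δ)
    (hd : ∀ q : Fin 3, BoundsDisc S (spineHandlebody S q) δ) (hns : IsNonSeparating S δ) :
    ¬ SimplyConnectedSpace X :=
  Trisection.not_simplyConnectedSpace_of_reducing_nonseparating hT hc hd hns

/-! ### The reducible branch for homotopy 4-spheres, shadow discharged -/

/-- **On a simply connected GK-trisected 4-manifold every reducing curve — indeed every curve of
the central surface bounding a disc in each handlebody of the spine — separates the central
surface** (contrapositive of the shadow). [cite: ArandaZupan2025, §2 (p. 6)] -/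
theorem not_isNonSeparating_of_boundsDisc_of_simplyConnectedSpace {X : Type u}
    [TopologicalSpace X] [T2Space X] [SecondCountableTopology X]
    [ChartedSpace (EuclideanSpace ℝ (Fin 4)) X] [IsManifold (𝓡 4) ∞ X] [SimplyConnectedSpace X]
    {g : ℕ} {k : Fin 3 → ℕ} {S : Fin 3 → Set X} (hT : IsGKTrisection X g k S) {δ : Set X}
    (hc : IsCurve S δ) (hd : ∀ q : Fin 3, BoundsDisc S (spineHandlebody S q) δ) :
    ¬ IsNonSeparating S δ := fun hns =>
  Trisection.not_simplyConnectedSpace_of_reducing_nonseparating hT hc hd hns ‹_›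

/-- **The REDUCIBLE branch of Aranda–Zupan's theorem for homotopy 4-spheres, GIVEN only the
separating splitting fact and the genus-`≤ 2` fact** (PROVED glue; the `π₁`-shadow of the
non-separating case is now the tree's theorem
`Trisection.not_simplyConnectedSpace_of_reducing_nonseparating`).  A closed connected oriented
smooth `X ≃ₕ S⁴` with a REDUCIBLE genus-`3` GK-trisection is diffeomorphic to `S⁴`: `X` is simply
connected, so the reducing curve separates; the separating splitting fact writes `X = X₁ # X₂`
with trisections of genera `≤ 2`; the summands are homotopy 4-spheres (Kosinski VI.2.1,
discharged), hence `S⁴` by the genus-`≤ 2` fact, and `S⁴ # S⁴ ≅ S⁴`.  Aranda–Zupan §6 p. 20, first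
paragraph of the proof of Thm. 1.3 ("If `T` is reducible, then … `X = X′ # X″` … [MZ17b]"), with
§2 p. 6, for homotopy spheres.
[cite: ArandaZupan2025, §6 (p. 20, reducible case) and §2 (p. 6)] [cite: MeierZupan2017, Thm. 1.2] -/
theorem nonempty_diffeomorph_sphere_of_isReducible_genusThree_of_sep
    (hsep : isConnectedSum_of_reducing_separating.{u})
    (hMZ : mz_genus_le_two_homotopySphere_gk.{u})
    (X : Type u) [TopologicalSpace X] [T2Space X] [SecondCountableTopology X]
    [ChartedSpace (EuclideanSpace ℝ (Fin 4)) X] [IsManifold (𝓡 4) ∞ X] [CompactSpace X]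
    [ConnectedSpace X] (o : SmoothOrientation (𝓡 4) X) (k : Fin 3 → ℕ) (S : Fin 3 → Set X)
    (hT : IsGKTrisection X 3 k S) (hred : IsReducible S)
    (e : X ≃ₕ (Metric.sphere (0 : EuclideanSpace ℝ (Fin (4 + 1))) 1)) :
    Nonempty (X ≃ₘ⟮𝓡 4, 𝓡 4⟯ (Metric.sphere (0 : EuclideanSpace ℝ (Fin (4 + 1))) 1)) := by
  haveI : SimplyConnectedSpace (Metric.sphere (0 : EuclideanSpace ℝ (Fin (4 + 1))) 1) :=
    simplyConnectedSpace_sphere_four_holds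
  haveI : SimplyConnectedSpace X := e.simplyConnectedSpace
  exact nonempty_diffeomorph_sphere_of_isReducible_genusThree_of_separates hsep hMZ X o k S hT hred
    (fun δ hc _ hd => not_isNonSeparating_of_boundsDisc_of_simplyConnectedSpace hT hc hd) e

/-- **The reducible branch from the Meier–Schirmer–Zupan classification and the separating
splitting fact alone** (PROVED glue): the genus-`≤ 2` input is a corollary of the classification
(`mz_genus_le_two_homotopySphere_gk_of_classification`, universe-free).
[cite: ArandaZupan2025, §6 (p. 20, reducible case)] [cite: MeierSchirmerZupan2016, Thm. 1.2] [cite: MeierZupan2017, Thm. 1.2] -/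
theorem nonempty_diffeomorph_sphere_of_isReducible_genusThree_of_classification_of_sep
    (hC : msz_trisection_classification_gk.{v})
    (hsep : isConnectedSum_of_reducing_separating.{u})
    (X : Type u) [TopologicalSpace X] [T2Space X] [SecondCountableTopology X]
    [ChartedSpace (EuclideanSpace ℝ (Fin 4)) X] [IsManifold (𝓡 4) ∞ X] [CompactSpace X]
    [ConnectedSpace X] (o : SmoothOrientation (𝓡 4) X) (k : Fin 3 → ℕ) (S : Fin 3 → Set X)
    (hT : IsGKTrisection X 3 k S) (hred : IsReducible S)
    (e : X ≃ₕ (Metric.sphere (0 : EuclideanSpace ℝ (Fin (4 + 1))) 1)) :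
    Nonempty (X ≃ₘ⟮𝓡 4, 𝓡 4⟯ (Metric.sphere (0 : EuclideanSpace ℝ (Fin (4 + 1))) 1)) :=
  nonempty_diffeomorph_sphere_of_isReducible_genusThree_of_sep hsep
    (mz_genus_le_two_homotopySphere_gk_of_msz_alone (msz_homotopySphere_gk_of_classification_univ hC))
    X o k S hT hred e

/-! ### Where the fact stands -/

/-- **Aranda–Zupan's homotopy-sphere fact from `msz_homotopySphere_gk`, the SEPARATING splitting
fact and the irreducible core** (PROVED glue, shadow discharged).  GIVEN, at universe `u`,
`msz_homotopySphere_gk` (Meier–Schirmer–Zupan, homotopy-sphere form),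
`Trisection.isConnectedSum_of_reducing_separating`, and — inline, NOT a named fact — Aranda–Zupan's
IRREDUCIBLE CORE `hirr` (a closed connected oriented `X` with a balanced `(3; 1)`-trisection
carrying a weak reduction with fixed labels and no reducing curve, homotopy equivalent to `S⁴`, is
`S⁴`: Prop. 3.9, §4, Thm. 1.3 first part, Lemma 5.4, Prop. 5.5, [MZ17b], Pao), the fact holds:
`az2025_weaklyReducible_genusThree_homotopySphere_gk_of_msz_of_sep_of_pi1_of_irreducible` with
its `π₁`-hypothesis fed by `Trisection.not_simplyConnectedSpace_of_reducing_nonseparating`.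
[cite: ArandaZupan2025, Thm. 1.3 (p. 2), §6 (pp. 20–24), §2 (p. 6), Prop. 5.5] [cite: MeierSchirmerZupan2016, Thm. 1.2] -/
theorem az2025_weaklyReducible_genusThree_homotopySphere_gk_of_msz_of_sep_of_irreducible
    (hMSZ : msz_homotopySphere_gk.{u})
    (hsep : isConnectedSum_of_reducing_separating.{u})
    (hirr : ∀ (X : Type u) [TopologicalSpace X] [T2Space X] [SecondCountableTopology X]
      [ChartedSpace (EuclideanSpace ℝ (Fin 4)) X] [IsManifold (𝓡 4) ∞ X] [CompactSpace X]
      [ConnectedSpace X] (_ : SmoothOrientation (𝓡 4) X) (S : Fin 3 → Set X),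
      IsBalancedGKTrisection X 3 1 S →
      (∃ c c' : Set X, IsCurve S c ∧ IsCurve S c' ∧ Disjoint c c' ∧
        IsNonSeparating S c ∧ IsNonSeparating S c' ∧
        BoundsDisc S (spineHandlebody S 0) c ∧ BoundsDisc S (spineHandlebody S 1) c' ∧
        BoundsDisc S (spineHandlebody S 2) c') →
      ¬ IsReducible S → X ≃ₕ (Metric.sphere (0 : EuclideanSpace ℝ (Fin (4 + 1))) 1) →
        Nonempty (X ≃ₘ⟮𝓡 4, 𝓡 4⟯ (Metric.sphere (0 : EuclideanSpace ℝ (Fin (4 + 1))) 1))) :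
    az2025_weaklyReducible_genusThree_homotopySphere_gk.{u} :=
  az2025_weaklyReducible_genusThree_homotopySphere_gk_of_msz_of_sep_of_pi1_of_irreducible hMSZ hsep
    not_simplyConnectedSpace_of_reducing_nonseparating_binderShape.{u} hirr

/-- **`Type 0` data suffice, shadow discharged** (PROVED glue): GIVEN, at universe `0` ONLY,
`msz_homotopySphere_gk`, the separating splitting fact and Aranda–Zupan's irreducible core, the
fact holds at EVERY universe
(`az2025_weaklyReducible_genusThree_homotopySphere_gk_of_facts_zero_of_pi1_zero_of_irreducible_zero`
with `hπ₀` fed by the theorem).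
[cite: ArandaZupan2025, Thm. 1.3 (p. 2), §6 (pp. 20–24), §2 (p. 6), Prop. 5.5] [cite: MeierSchirmerZupan2016, Thm. 1.2] -/
theorem az2025_weaklyReducible_genusThree_homotopySphere_gk_of_msz_zero_of_sep_zero_of_irreducible_zero
    (hMSZ₀ : msz_homotopySphere_gk.{0})
    (hsep₀ : isConnectedSum_of_reducing_separating.{0})
    (hirr₀ : ∀ (X : Type) [TopologicalSpace X] [T2Space X] [SecondCountableTopology X]
      [ChartedSpace (EuclideanSpace ℝ (Fin 4)) X] [IsManifold (𝓡 4) ∞ X] [CompactSpace X]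
      [ConnectedSpace X] (_ : SmoothOrientation (𝓡 4) X) (S : Fin 3 → Set X),
      IsBalancedGKTrisection X 3 1 S →
      (∃ c c' : Set X, IsCurve S c ∧ IsCurve S c' ∧ Disjoint c c' ∧
        IsNonSeparating S c ∧ IsNonSeparating S c' ∧
        BoundsDisc S (spineHandlebody S 0) c ∧ BoundsDisc S (spineHandlebody S 1) c' ∧
        BoundsDisc S (spineHandlebody S 2) c') →
      ¬ IsReducible S → X ≃ₕ (Metric.sphere (0 : EuclideanSpace ℝ (Fin (4 + 1))) 1) →
        Nonempty (X ≃ₘ⟮𝓡 4, 𝓡 4⟯ (Metric.sphere (0 : EuclideanSpace ℝ (Fin (4 + 1))) 1))) :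
    az2025_weaklyReducible_genusThree_homotopySphere_gk.{u} :=
  az2025_weaklyReducible_genusThree_homotopySphere_gk_of_facts_zero_of_pi1_zero_of_irreducible_zero
    hMSZ₀ hsep₀ not_simplyConnectedSpace_of_reducing_nonseparating_binderShape.{0} hirr₀

/-- **The same, over the Meier–Schirmer–Zupan classification at any universe** (PROVED glue):
`az2025_weaklyReducible_genusThree_homotopySphere_gk_of_classification_of_sep_of_pi1_of_irreducible`
with `hπ₀` fed by the theorem.
[cite: ArandaZupan2025, Thm. 1.3 (p. 2), §6 (pp. 20–24), §2 (p. 6), Prop. 5.5] [cite: MeierSchirmerZupan2016, Thm. 1.2] -/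
theorem az2025_weaklyReducible_genusThree_homotopySphere_gk_of_classification_of_sep_zero_of_irreducible_zero
    (hC : msz_trisection_classification_gk.{v})
    (hsep₀ : isConnectedSum_of_reducing_separating.{0})
    (hirr₀ : ∀ (X : Type) [TopologicalSpace X] [T2Space X] [SecondCountableTopology X]
      [ChartedSpace (EuclideanSpace ℝ (Fin 4)) X] [IsManifold (𝓡 4) ∞ X] [CompactSpace X]
      [ConnectedSpace X] (_ : SmoothOrientation (𝓡 4) X) (S : Fin 3 → Set X),
      IsBalancedGKTrisection X 3 1 S →
      (∃ c c' : Set X, IsCurve S c ∧ IsCurve S c' ∧ Disjoint c c' ∧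
        IsNonSeparating S c ∧ IsNonSeparating S c' ∧
        BoundsDisc S (spineHandlebody S 0) c ∧ BoundsDisc S (spineHandlebody S 1) c' ∧
        BoundsDisc S (spineHandlebody S 2) c') →
      ¬ IsReducible S → X ≃ₕ (Metric.sphere (0 : EuclideanSpace ℝ (Fin (4 + 1))) 1) →
        Nonempty (X ≃ₘ⟮𝓡 4, 𝓡 4⟯ (Metric.sphere (0 : EuclideanSpace ℝ (Fin (4 + 1))) 1))) :
    az2025_weaklyReducible_genusThree_homotopySphere_gk.{u} :=
  az2025_weaklyReducible_genusThree_homotopySphere_gk_of_classification_of_sep_of_pi1_of_irreducible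
    hC hsep₀ not_simplyConnectedSpace_of_reducing_nonseparating_binderShape.{0} hirr₀

/-! ### The printed endgame, shadow discharged -/

/-- **Aranda–Zupan's homotopy-sphere fact, at every universe, from the Meier–Schirmer–Zupan
classification (any universe), the separating splitting fact, the loop-surgery fact and the
five-chain surgery step (the last three at universe `0`)** — PROVED glue:
`az2025_weaklyReducible_genusThree_homotopySphere_gk_of_classification_of_sep_of_pi1_of_loopSurgery_of_fiveChainSurgery`
with its `π₁`-hypothesis fed by `Trisection.not_simplyConnectedSpace_of_reducing_nonseparating`.
Reducible branch: Aranda–Zupan §6 p. 20 first paragraph and §2 p. 6; irreducible branch: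
Prop. 3.9, §4, Thm. 1.3 first part, Lemma 5.4, Prop. 5.5 (the inline hypothesis `h5`: an
irreducible weakly reducible balanced `(3; 1)`-trisected `X : Type` is a circle surgery on a loop
of some `X′ : Type` with a genus-`2` GK-trisection in the MSZ range) and the [MZ17b]/Pao endgame
(the loop-surgery fact `msz_loopSurgery_homotopySphere_gk`).
[cite: ArandaZupan2025, Thm. 1.3 (p. 2), §6 (pp. 20–24), Lemma 5.4, Prop. 5.5] [cite: MeierSchirmerZupan2016, Thm. 1.2] -/
theorem az2025_weaklyReducible_genusThree_homotopySphere_gk_of_classification_of_sep_of_loopSurgery_of_fiveChainSurgery'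
    (hC : msz_trisection_classification_gk.{v})
    (hsep₀ : isConnectedSum_of_reducing_separating.{0})
    (hL : msz_loopSurgery_homotopySphere_gk)
    (h5 : ∀ (X : Type) [TopologicalSpace X] [T2Space X] [SecondCountableTopology X]
      [ChartedSpace (EuclideanSpace ℝ (Fin 4)) X] [IsManifold (𝓡 4) ∞ X] [CompactSpace X]
      [ConnectedSpace X] (_ : SmoothOrientation (𝓡 4) X) (S : Fin 3 → Set X),
      IsBalancedGKTrisection X 3 1 S →
      (∃ c c' : Set X, IsCurve S c ∧ IsCurve S c' ∧ Disjoint c c' ∧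
        IsNonSeparating S c ∧ IsNonSeparating S c' ∧
        BoundsDisc S (spineHandlebody S 0) c ∧ BoundsDisc S (spineHandlebody S 1) c' ∧
        BoundsDisc S (spineHandlebody S 2) c') →
      ¬ IsReducible S →
      ∃ (X' : Type) (_ : TopologicalSpace X') (_ : T2Space X') (_ : SecondCountableTopology X')
        (_ : ChartedSpace (EuclideanSpace ℝ (Fin 4)) X') (_ : IsManifold (𝓡 4) ∞ X')
        (k' : Fin 3 → ℕ) (S' : Fin 3 → Set X')
        (ℓ : Metric.sphere (0 : EuclideanSpace ℝ (Fin 2)) 1 → X'),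
        IsGKTrisection X' 2 k' S' ∧ (∃ i, 2 ≤ k' i + 1) ∧
          Manifold.IsSmoothEmbedding (𝓡 1) (𝓡 4) ∞ ℓ ∧ IsCircleSurgery (𝓡 4) (𝓡 4) X' X ℓ) :
    az2025_weaklyReducible_genusThree_homotopySphere_gk.{u} :=
  az2025_weaklyReducible_genusThree_homotopySphere_gk_of_classification_of_sep_of_pi1_of_loopSurgery_of_fiveChainSurgery
    hC hsep₀ not_simplyConnectedSpace_of_reducing_nonseparating_binderShape.{0} hL h5

/-- **The same assembly over `msz_homotopySphere_gk.{0}` instead of the classification**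
(PROVED glue, shadow discharged):
`az2025_weaklyReducible_genusThree_homotopySphere_gk_of_msz_zero_of_sep_of_pi1_of_loopSurgery_of_fiveChainSurgery`
with `hπ₀` fed by the theorem.
[cite: ArandaZupan2025, Thm. 1.3 (p. 2), §6 (pp. 20–24), Lemma 5.4, Prop. 5.5] [cite: MeierSchirmerZupan2016, Thm. 1.2] -/
theorem az2025_weaklyReducible_genusThree_homotopySphere_gk_of_msz_zero_of_sep_of_loopSurgery_of_fiveChainSurgery'
    (hMSZ₀ : msz_homotopySphere_gk.{0})
    (hsep₀ : isConnectedSum_of_reducing_separating.{0})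
    (hL : msz_loopSurgery_homotopySphere_gk)
    (h5 : ∀ (X : Type) [TopologicalSpace X] [T2Space X] [SecondCountableTopology X]
      [ChartedSpace (EuclideanSpace ℝ (Fin 4)) X] [IsManifold (𝓡 4) ∞ X] [CompactSpace X]
      [ConnectedSpace X] (_ : SmoothOrientation (𝓡 4) X) (S : Fin 3 → Set X),
      IsBalancedGKTrisection X 3 1 S →
      (∃ c c' : Set X, IsCurve S c ∧ IsCurve S c' ∧ Disjoint c c' ∧
        IsNonSeparating S c ∧ IsNonSeparating S c' ∧
        BoundsDisc S (spineHandlebody S 0) c ∧ BoundsDisc S (spineHandlebody S 1) c' ∧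
        BoundsDisc S (spineHandlebody S 2) c') →
      ¬ IsReducible S →
      ∃ (X' : Type) (_ : TopologicalSpace X') (_ : T2Space X') (_ : SecondCountableTopology X')
        (_ : ChartedSpace (EuclideanSpace ℝ (Fin 4)) X') (_ : IsManifold (𝓡 4) ∞ X')
        (k' : Fin 3 → ℕ) (S' : Fin 3 → Set X')
        (ℓ : Metric.sphere (0 : EuclideanSpace ℝ (Fin 2)) 1 → X'),
        IsGKTrisection X' 2 k' S' ∧ (∃ i, 2 ≤ k' i + 1) ∧
          Manifold.IsSmoothEmbedding (𝓡 1) (𝓡 4) ∞ ℓ ∧ IsCircleSurgery (𝓡 4) (𝓡 4) X' X ℓ) :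
    az2025_weaklyReducible_genusThree_homotopySphere_gk.{u} :=
  az2025_weaklyReducible_genusThree_homotopySphere_gk_of_msz_zero_of_sep_of_pi1_of_loopSurgery_of_fiveChainSurgery
    hMSZ₀ hsep₀ not_simplyConnectedSpace_of_reducing_nonseparating_binderShape.{0} hL h5

end Literature.Barriers.SmoothPoincare4

end
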